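import Mathlib
import Summits.ValiantsHypothesis.ValiantsHypothesis.Theorems.BarrierLeverDefinableEquationsSingularLocusMethodNatural
import Literature.Computability.AlgebraicComplexity.CKSV22HomogeneousSingularLocusBounds
import HarnessLib

/-!
# Route BarrierLever — crux `DefinableEquations` (stmt-8745) / item `SingleSizeEquations`
# (stmt-8749), MODEL AXIS (ABPs): CKSV 2022 Theorem 2 (UNLAYERED ABPs, `Ω(n log n / log log n)`
# edges) is natural at level `O(log n)` — the third ABP model of the paper (val-np-p5 g23)

Companion of `…SingularLocusMethodNatural` §10 and `…QuasiLevel`.  For a homogeneous degree-`n`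
form `f` in `n` variables the all-variable certificate `certPoly n n` (level `14·log₂ n + 25`,
quasi-polynomial size) is nonzero exactly at the SMOOTH forms; a smooth form has gradient ideal of
height `n` (§1 of `…SingularLocusMethod`: a prime of height `< n` has a non-trivial zero), which is
the plain singular-locus hypothesis of the tree's `CKSV2022.thm_2_of_isHomogeneous` (CKSV Thm. 2 /
Cor. 20 for an arbitrary homogeneous polynomial, PROVED in the tree by Valiant's depth reduction):
an unlayered ABP (`CKSV2022.UnlayeredABPComputes τ m 1`: topologically numbered DAG, affine labels,
`m` edges) computing `f` has `n·log₂ n ≤ 4m(log₂ log₂ n + 4)` once `16 log₂ n ≤ n`.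

* `aeval_restr_self` — restricting to all `n` coordinates is the identity;
* `height_ge_of_smooth` — smooth form ⇒ every prime over its gradient ideal has height `≥ n`;
* **`isNaturalProof_certPoly_unlayeredABP_full`** — for `n ≥ 2^7`, `certPoly n n` is an
  `IsNaturalProof` of level `14·log₂ n + 25` against degree-`n` forms with an unlayered ABP of `m`
  edges, `4m(log₂ log₂ n + 4) < n·log₂ n`.

At constant level the same route only reaches a SUBLINEAR edge count (`O(c·n / log log n)`, below
the circuit item 20156), so no constant-level statement is recorded.  WHAT THIS IS NOT: nothing on
general circuits of size `n²`, 8746, 14610 or `VP` vs `VNP`; no definitions, no named facts.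
Refs: [ChatterjeeKumarSheVolk2022] Thm. 2 / Cor. 20, Lemma 16 (Valiant); [ForbesShpilkaVolk2018] Def. 1.
-/

set_option linter.dupNamespace false

noncomputable section

namespace Summit.ValiantsHypothesis.ValiantsHypothesis.Theorems.BarrierLeverDefinableEquations

open MvPolynomial Finset
open Literature.Computability.AlgebraicComplexity
open Literature.Barriers.ValiantsHypothesis
open Literature.RingTheory.MvPolynomial.Macaulay
open Summit.ValiantsHypothesis.ValiantsHypothesis.Theorems.BarrierLever.NaturalProofsAgainstAllLinearSizes
open scoped BigOperators

namespace SingularLocusMethod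

/-- Restricting to ALL `n` coordinates is the identity substitution. [folklore] -/
theorem aeval_restr_self {n : ℕ} (f : MvPolynomial (Fin n) ℂ) : aeval (restr ℂ n n) f = f := by
  have h : restr ℂ n n = fun j => X j := by
    funext j
    have := restr_castLE (R := ℂ) (le_refl n) j
    simpa using this
  rw [h]
  exact aeval_X_left_apply f

/-- **Smooth forms have gradient ideal of full height.** If the `n` partials of `f ∈ ℂ[x_1..x_n]`
have only the trivial common zero, every prime containing them has height `≥ n` (§1 of
`…SingularLocusMethod`). [cite: ChatterjeeKumarSheVolk2022, §1.5 (Claim 9 pattern)] -/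
theorem height_ge_of_smooth {n : ℕ} {f : MvPolynomial (Fin n) ℂ}
    (hsm : ∀ ξ : Fin n → ℂ, (∀ i, eval ξ (pderiv i f) = 0) → ξ = 0) :
    ∀ P : Ideal (MvPolynomial (Fin n) ℂ), P.IsPrime → (∀ i, pderiv i f ∈ P) →
      (n : ℕ∞) ≤ P.height := by
  intro P hP hPi
  by_contra hlt
  rw [not_le] at hlt
  haveI := hP
  obtain ⟨ξ, hξ0, hξ⟩ := exists_ne_zero_mem_zeroLocus_of_height_lt P hlt
  exact hξ0 (hsm ξ fun i => hξ _ (hPi i))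

/-- `16 · log₂ n ≤ n` for `n ≥ 2^7`. [folklore] -/
theorem sixteen_mul_log_le {n : ℕ} (hn : 2 ^ 7 ≤ n) : 16 * Nat.log 2 n ≤ n := by
  set j := Nat.log 2 n with hj
  have hj7 : 7 ≤ j := Nat.le_log_of_pow_le (by norm_num) hn
  have hpow : 2 ^ j ≤ n := Nat.pow_log_le_self 2 (by omega)
  obtain ⟨r, hr⟩ : ∃ r, j = r + 7 := ⟨j - 7, by omega⟩
  -- `16 (r + 7) ≤ 128 · 2^r` since `16 r + 112 ≤ 128 (r + 1)`
  calc 16 * j = 16 * (r + 7) := by rw [hr]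
    _ ≤ 128 * (r + 1) := by omega
    _ ≤ 128 * 2 ^ r := Nat.mul_le_mul_left _ (by
        have := @Nat.lt_two_pow_self r
        omega)
    _ = 2 ^ (r + 7) := by rw [pow_add]; ring
    _ = 2 ^ j := by rw [hr]
    _ ≤ n := hpow

/-- **CKSV Theorem 2 (unlayered ABPs), natural at level `O(log n)`.**  For `n ≥ 2^7`, the
all-variable certificate `certPoly n n` is an `IsNaturalProof` of level `14·log₂ n + 25` against the
degree-`n` forms computed by an unlayered ABP with affine labels and `m` edges,
`4m(log₂ log₂ n + 4) < n · log₂ n`. [cite: ChatterjeeKumarSheVolk2022, Thm. 2 and Cor. 20] -/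
theorem isNaturalProof_certPoly_unlayeredABP_full {n : ℕ} (hn : 2 ^ 7 ≤ n) :
    IsNaturalProof (degLEMonomials n)
      {f : MvPolynomial (Fin n) ℂ | f.IsHomogeneous n ∧ ∃ τ m : ℕ,
        4 * m * (Nat.log 2 (Nat.log 2 n) + 4) < n * Nat.log 2 n ∧
          CKSV2022.UnlayeredABPComputes τ m 1 f}
      (Distinguishers ℂ n (7 * (2 * (Nat.log 2 n + 1)) + 11)) (certPoly n n) := by
  have hn2 : 2 ≤ n := le_trans (by norm_num) hn
  obtain ⟨hmem, hne⟩ := certPoly_self_mem_distinguishers hn2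
  refine ⟨hmem, hne, fun f hf => ?_⟩
  obtain ⟨hfhom, τ, m, hm, hABP⟩ := hf
  rw [eval_certPoly n f hfhom.totalDegree_le, aeval_restr_self, homogeneousComponent_eq_self hfhom]
  by_contra hdet
  have hsm := eq_zero_of_det_macaulay_grad_ne_zero f hfhom hdet
  have hle := CKSV2022.thm_2_of_isHomogeneous (c := n) (a := 0) hn2 le_rfl hfhom
    (height_ge_of_smooth hsm) (by simpa using sixteen_mul_log_le hn) (by simp) hABP
  simp only [Nat.log_one_right, add_zero] at hle
  omega

end SingularLocusMethod

end Summit.ValiantsHypothesis.ValiantsHypothesis.Theorems.BarrierLeverDefinableEquations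

end
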